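import Summits.QuantumFields.YangMills.Theorems.BalabanLadderIRColdPurityBridgeRungs

/-!
# Route `BalabanLadder`, crux `IR` (stmt-QuantumFields-19354): the COLD-PURITY BRIDGE — §6 R in SPECTRAL currency

Third of the three files into which ideator ym-ir-idea-6's sorry-free helper module (rev 3b, 2026-08-28, evidence on
19354) is split at landing (lead prover ym-ir-line-bsf-p1 g2; gate limit 400 lines per Theorems file).  Text and
declarations of the ideator's §6 unchanged; §§1–4 are `BalabanLadderIRColdPurityBridge.lean`, §5 is
`BalabanLadderIRColdPurityBridgeRungs.lean`.  `--supports stmt-QuantumFields-19354`; no registered stub is claimed.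

HONEST FRAMING.  The Yang–Mills mass gap (Clay) is NOT proved by anything here; R4 (`BalabanUVStability4`) closes only the
conditional finite-𝕋⁴ rung `BalabanLadder.UV`.  `SpectralDiagonalContractionSC` is an OPEN obligation (typed, not claimed);
what is proved is its equivalence with R (`ColdDoublingRecursionSC`) up to constants.
-/

set_option autoImplicit false

noncomputable section

open Filter Topology MeasureTheory
open scoped SchwartzMap
open Literature.MathematicalPhysics.QuantumFieldTheory Literature.MathematicalPhysics.QuantumLattice
open Summit.QuantumFields.YangMills.Cruxes.OSLegsFromFemtoAndGap.DlrCollarTransfer (GapInUnits LowerBounds Q2)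
open Literature.MathematicalPhysics.QuantumFieldTheory.Balaban1983to89.Sufficient (ColdPressureBound)
open Summit.QuantumFields.YangMills.Theorems.DoublingDefect (coldDefect_nonneg traceExcess_le_of_coldDefect_le
  traceExcess_le_exp_of_le defect_decay_of_recursion)
open Summit.QuantumFields.YangMills.Cruxes.IR.ColdPressurePincer

namespace Summit.QuantumFields.YangMills.Cruxes.IR.ColdPurityBridge

/-! ## §6 R in SPECTRAL currency (the dictionary purity defect ↔ thermal trace excess, made two-sided; PROVED reduction)

`δᶜ` and the trace excess `x_t(N) = Σ_{i ≠ 0} (λᵢ/λ₀)^t` of the torus transfer matrix at the cold time `t = ⌊L/4⌋` are the SAME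
quantity up to a factor: `2x/(1+x)² ≤ δᶜ ≤ 2x` (`one_sub_ratio_ge_of_traceExcess`, `one_sub_ratio_le_two_mul_traceExcess`).  Hence
R is, past the exit, a statement about the low-lying transfer-matrix spectrum under SIMULTANEOUS doubling of the spatial torus
and of the Euclidean time: `SpectralDiagonalContractionSC` («`x_{⌊L'/4⌋}(L') ≤ C·x_{⌊L/4⌋}(L)²` whenever `x_{⌊L/4⌋}(L) ≤ x₀`»,
i.e. `m(β, L')·L'/4 ≥ 2·m(β, L)·L/4 − log C` with multiplicities: the finite-volume mass does not drop under spatial doubling by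
more than `O(1/L)`, cf. Lüscher's negative finite-size mass shift) is EQUIVALENT to R up to constants — both directions
PROVED: `coldDoublingRecursionSC_of_spectral` (the large-defect regime `δᶜ(L) > η₀` is free because `δᶜ(L') ≤ 1`) and
`spectral_of_coldDoublingRecursionSC` (`x₀ = min 1 (1/(16C))`, `C ↦ 8C`). -/

section Spectral

variable {G : Type} [Group G] [TopologicalSpace G] [IsTopologicalGroup G] [CompactSpace G]
  [MeasurableSpace G] [BorelSpace G]

open Summit.QuantumFields.YangMills.Theorems.DoublingDefect (exists_ratios_hasSum_traceExcess)

/-- **Lower bound: the trace excess forces impurity**: `2x/(1+x)² ≤ 1 − Z(N³×2t)/Z(N³×t)²` with `x = x_t(N)`, `t = m+2`,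
`β ≥ 0` — because `x_{2t} = Σ_{i≠0} rᵢ^{2t} ≤ x_t²` (each `rᵢ^t ≤ x_t`), so `Z(2t)/Z(t)² = (1+x_{2t})/(1+x_t)² ≤ (1+x²)/(1+x)²`. -/
theorem one_sub_ratio_ge_of_traceExcess (r : LatticeRep G) {β : ℝ} (hβ : 0 ≤ β) (N m : ℕ) [NeZero N] :
    2 * traceExcess r.ρ β N (m + 2) / (1 + traceExcess r.ρ β N (m + 2)) ^ 2 ≤
      1 - wilsonFinTorusPartition r.ρ β N N N (2 * (m + 2)) / wilsonFinTorusPartition r.ρ β N N N (m + 2) ^ 2 := by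
  haveI : SecondCountableTopology G :=
    (r.continuous.isClosedEmbedding r.injective).isEmbedding.secondCountableTopology
  obtain ⟨ι, _, q, i₀, hq, hqi₀, hpos, hT, hx⟩ :=
    exists_ratios_hasSum_traceExcess r.continuous r.mem_unitary hβ N
  set lp : ℝ := transferSpectralRadius r.ρ β N with hlp
  set W₁ : ℝ := wilsonFinTorusPartition r.ρ β N N N (m + 2) with hW₁
  set W₂ : ℝ := wilsonFinTorusPartition r.ρ β N N N (2 * (m + 2)) with hW₂
  set x : ℝ := traceExcess r.ρ β N (m + 2) with hxdef
  have hW₁pos : 0 < W₁ := wilsonFinTorusPartition_pos r.continuous β N N N (m + 2)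
  have hT₁ := hT m
  have hT₂ : HasSum (fun i => q i ^ (2 * m + 2 + 2)) (W₂ / lp ^ (2 * (m + 2))) := by
    have h := hT (2 * m + 2)
    rw [show 2 * m + 2 + 2 = 2 * (m + 2) from by ring] at h ⊢
    exact h
  set T₁ : ℝ := W₁ / lp ^ (m + 2) with hT₁def
  set T₂ : ℝ := W₂ / lp ^ (2 * (m + 2)) with hT₂def
  -- `x = T₁ - 1`, `x ≥ 0`
  have hx₁ := hx m
  have hxT : x = T₁ - 1 := by
    have h' : HasSum (Function.update (fun i => q i ^ (m + 2)) i₀ 0) (0 - 1 + T₁) := by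
      have := hT₁.update i₀ 0
      simpa [hqi₀] using this
    have := hx₁.unique h'
    rw [hxdef]; linarith
  have hx0 : 0 ≤ x := by
    rw [hxdef]
    refine hx₁.nonneg (fun i => ?_)
    rcases eq_or_ne i i₀ with h | h
    · simp [h]
    · simp [Function.update_of_ne h, pow_nonneg (hq i).1]
  -- each excited ratio power is at most `x`
  have hqi : ∀ i, i ≠ i₀ → q i ^ (m + 2) ≤ x := by
    intro i hi
    have h := le_hasSum hx₁ i fun j _ => by
      rcases eq_or_ne j i₀ with h | h
      · simp [h]
      · simp [Function.update_of_ne h, pow_nonneg (hq j).1]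
    simpa [Function.update_of_ne hi] using h
  -- `x₂ ≤ x²` where `1 + x₂ = T₂`
  have hx₂ := hx (2 * m + 2)
  have hx₂' : HasSum (Function.update (fun i => q i ^ (2 * m + 2 + 2)) i₀ 0) (-1 + T₂) := by
    have := hT₂.update i₀ 0
    simpa [hqi₀] using this
  have hle : ∀ i, Function.update (fun i => q i ^ (2 * m + 2 + 2)) i₀ 0 i ≤
      x * Function.update (fun i => q i ^ (m + 2)) i₀ 0 i := by
    intro i
    rcases eq_or_ne i i₀ with h | h
    · simp [h]
    · simp only [Function.update_of_ne h]
      have hsq : q i ^ (2 * m + 2 + 2) = q i ^ (m + 2) * q i ^ (m + 2) := by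
        rw [← pow_add]; congr 1; ring
      rw [hsq]
      exact mul_le_mul_of_nonneg_right (hqi i h) (pow_nonneg (hq i).1 _)
  have hT₂le : -1 + T₂ ≤ x * x := hasSum_le hle hx₂' (hx₁.mul_left x)
  -- conclude: `1 - T₂/T₁² ≥ 1 - (1 + x²)/(1 + x)² = 2x/(1+x)²`
  have hT₁pos : 0 < T₁ := by rw [show T₁ = 1 + x from by linarith]; positivity
  have hid : W₂ / W₁ ^ 2 = T₂ / T₁ ^ 2 := by
    have h1 : lp ^ (m + 2) ≠ 0 := pow_ne_zero _ hpos.ne'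
    have h2 : W₁ ≠ 0 := hW₁pos.ne'
    rw [hT₂def, hT₁def]
    field_simp
    ring
  rw [hid, show T₁ = 1 + x from by linarith]
  have h1x : 0 < (1 + x) ^ 2 := by positivity
  rw [div_le_iff₀ h1x, sub_mul, div_mul_cancel₀ _ h1x.ne']
  nlinarith [hT₂le]

/-- **R in spectral currency (OPEN; a sufficient form of `ColdDoublingRecursionSC`).**  For compact simple SIMPLY-CONNECTED `G`
and every `r`: there are `x₀ > 0`, `C > 0`, `β₀`, `L₀` such that for `β ≥ β₀`, `L ≥ L₀`, `2L ≤ L' ≤ 4L`: if the cold trace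
excess at size `L` is small, `x_{⌊L/4⌋}(L) ≤ x₀`, then `x_{⌊L'/4⌋}(L') ≤ C · x_{⌊L/4⌋}(L)²` — simultaneous doubling of space
and time squares the thermal multiplicity of the excited tower (rate per unit length retained, all slack in `C`).  Instance
binders `[NeZero L]` and the parametrisation `⌊L/4⌋ = m + 2` (so `L ≥ 8`) make the trace excess well-typed.
[conjectural obligation; open] -/
def SpectralDiagonalContractionSC : Prop :=
  ∀ (G : Type) [Group G] [TopologicalSpace G] [IsTopologicalGroup G] [CompactSpace G],
    IsCompactSimpleLieGroup G → SimplyConnectedSpace G →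
    letI : MeasurableSpace G := borel G
    haveI : BorelSpace G := ⟨rfl⟩
    ∀ r : LatticeRep G, ∃ x₀ : ℝ, 0 < x₀ ∧ ∃ C : ℝ, 0 < C ∧ ∃ β₀ : ℝ, ∃ L₀ : ℕ, ∀ β : ℝ, β₀ ≤ β →
      ∀ (L : ℕ) [NeZero L] (m : ℕ), L / 4 = m + 2 → L₀ ≤ L →
        ∀ (L' : ℕ) [NeZero L'] (m' : ℕ), L' / 4 = m' + 2 → 2 * L ≤ L' → L' ≤ 4 * L →
          traceExcess r.ρ β L (m + 2) ≤ x₀ →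
            traceExcess r.ρ β L' (m' + 2) ≤ C * traceExcess r.ρ β L (m + 2) ^ 2

/-- **Spectral contraction ⇒ R (PROVED).**  With `η₀ = min (1/4) (x₀/2)`: if `δᶜ_β(L) ≤ η₀` then `x(L) ≤ 2η₀ ≤ x₀`
(`traceExcess_le_of_coldDefect_le`), the spectral contraction gives `x(L') ≤ C x(L)²`, and `δᶜ(L') ≤ 2x(L')`,
`x(L) ≤ ((1+x₀)²/2)·δᶜ(L)` (two-sided dictionary) give `δᶜ(L') ≤ (C(1+x₀)⁴/2)·δᶜ(L)²`; if `δᶜ_β(L) > η₀` then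
`δᶜ(L') ≤ 1 ≤ η₀⁻²·δᶜ(L)²`.  So R holds with `C_R = max (C(1+x₀)⁴/2) η₀⁻²`, `β₀ ↦ max β₀ 0`, `L₀ ↦ max L₀ 8`. -/
theorem coldDoublingRecursionSC_of_spectral (hS : SpectralDiagonalContractionSC) : ColdDoublingRecursionSC := by
  intro G _ _ _ _ hG hsc
  letI : MeasurableSpace G := borel G
  haveI : BorelSpace G := ⟨rfl⟩
  intro r
  haveI : SecondCountableTopology G :=
    (r.continuous.isClosedEmbedding r.injective).isEmbedding.secondCountableTopology
  obtain ⟨x₀, hx₀, C, hC, β₀, L₀, h⟩ := hS G hG hsc r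
  set η₀ : ℝ := min (1 / 4) (x₀ / 2) with hη₀
  have hη₀pos : 0 < η₀ := lt_min (by norm_num) (by linarith)
  have hη₀le : η₀ ≤ 1 / 4 := min_le_left _ _
  have hη₀x : 2 * η₀ ≤ x₀ := by have := min_le_right (1 / 4 : ℝ) (x₀ / 2); linarith
  set CR : ℝ := max (C * (1 + x₀) ^ 4 / 2) (η₀⁻¹ ^ 2) with hCR
  have hCRpos : 0 < CR := lt_of_lt_of_le (by positivity) (le_max_right _ _)
  refine ⟨CR, max β₀ 0, max L₀ 8, hCRpos, fun β hβ L hL L' hLL' hL'L => ?_⟩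
  have hβ0 : 0 ≤ β := le_trans (le_max_right _ _) hβ
  have hββ₀ : β₀ ≤ β := le_trans (le_max_left _ _) hβ
  have hL8 : 8 ≤ L := le_trans (le_max_right _ _) hL
  have hLL₀ : L₀ ≤ L := le_trans (le_max_left _ _) hL
  haveI : NeZero L := ⟨by omega⟩
  haveI : NeZero L' := ⟨by omega⟩
  obtain ⟨m, hm⟩ : ∃ m : ℕ, L / 4 = m + 2 := ⟨L / 4 - 2, by omega⟩
  obtain ⟨m', hm'⟩ : ∃ m' : ℕ, L' / 4 = m' + 2 := ⟨L' / 4 - 2, by omega⟩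
  -- the two defects, abbreviated
  have hδL'le1 : coldDefect r.ρ β L' ≤ 1 := by
    unfold coldDefect
    have hZ := wilsonFinTorusPartition_pos r.continuous β L' L' L' (2 * (L' / 4))
    have hZ' := wilsonFinTorusPartition_pos r.continuous β L' L' L' (L' / 4)
    have : 0 ≤ wilsonFinTorusPartition r.ρ β L' L' L' (2 * (L' / 4)) /
        wilsonFinTorusPartition r.ρ β L' L' L' (L' / 4) ^ 2 := div_nonneg hZ.le (sq_nonneg _)
    linarith
  have hδLnn : 0 ≤ coldDefect r.ρ β L := by
    unfold coldDefect; rw [hm]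
    exact coldDefect_nonneg r.continuous r.mem_unitary hβ0 L (m + 2) (by omega)
  by_cases hsmall : coldDefect r.ρ β L ≤ η₀
  · -- small-defect regime: go through the spectrum
    have hxL : traceExcess r.ρ β L (m + 2) ≤ 2 * η₀ := by
      refine traceExcess_le_of_coldDefect_le r.continuous r.mem_unitary hβ0 L m (by linarith) ?_
      have : coldDefect r.ρ β L ≤ η₀ := hsmall
      unfold coldDefect at this; rw [hm] at this; exact this
    have hxL0 : 0 ≤ traceExcess r.ρ β L (m + 2) := by
      have h1 := one_sub_ratio_ge_of_traceExcess r hβ0 L m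
      have h2 := one_sub_ratio_le_two_mul_traceExcess r hβ0 L m
      -- from `2x/(1+x)^2 ≤ δ ≤ 2x`: if x < 0 then δ ≤ 2x < 0 ≤ ... use δ ≥ 0 instead
      have hδ : 0 ≤ 1 - wilsonFinTorusPartition r.ρ β L L L (2 * (m + 2)) /
          wilsonFinTorusPartition r.ρ β L L L (m + 2) ^ 2 :=
        coldDefect_nonneg r.continuous r.mem_unitary hβ0 L (m + 2) (by omega)
      nlinarith [h2, hδ]
    have hspec := h β hββ₀ L m hm hLL₀ L' m' hm' hLL' hL'L
    have hxL' := hspec (by linarith)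
    -- δ(L') ≤ 2 x(L')
    have hup := one_sub_ratio_le_two_mul_traceExcess r hβ0 L' m'
    -- x(L) ≤ ((1+x₀)^2/2) δ(L)
    have hlow := one_sub_ratio_ge_of_traceExcess r hβ0 L m
    set x : ℝ := traceExcess r.ρ β L (m + 2) with hxdef
    set δ : ℝ := 1 - wilsonFinTorusPartition r.ρ β L L L (2 * (m + 2)) /
        wilsonFinTorusPartition r.ρ β L L L (m + 2) ^ 2 with hδdef
    have hx_le_x₀ : x ≤ x₀ := by linarith
    have hxδ : x ≤ (1 + x₀) ^ 2 / 2 * δ := by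
      have h1x : 0 < (1 + x) ^ 2 := by positivity
      have hkey : 2 * x ≤ δ * (1 + x) ^ 2 := by
        have := hlow; rwa [div_le_iff₀ h1x] at this
      have hmono : (1 + x) ^ 2 ≤ (1 + x₀) ^ 2 :=
        pow_le_pow_left₀ (by linarith) (by linarith) 2
      have hδ0 : 0 ≤ δ := coldDefect_nonneg r.continuous r.mem_unitary hβ0 L (m + 2) (by omega)
      nlinarith [mul_le_mul_of_nonneg_left hmono hδ0]
    have hgoal : coldDefect r.ρ β L' ≤ C * (1 + x₀) ^ 4 / 2 * coldDefect r.ρ β L ^ 2 := by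
      have hδL : coldDefect r.ρ β L = δ := by unfold coldDefect; rw [hm]
      have hδL' : coldDefect r.ρ β L' = 1 - wilsonFinTorusPartition r.ρ β L' L' L' (2 * (m' + 2)) /
          wilsonFinTorusPartition r.ρ β L' L' L' (m' + 2) ^ 2 := by unfold coldDefect; rw [hm']
      rw [hδL, hδL']
      have hx2 : x ^ 2 ≤ ((1 + x₀) ^ 2 / 2 * δ) ^ 2 := pow_le_pow_left₀ hxL0 hxδ 2
      calc 1 - wilsonFinTorusPartition r.ρ β L' L' L' (2 * (m' + 2)) /
            wilsonFinTorusPartition r.ρ β L' L' L' (m' + 2) ^ 2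
          ≤ 2 * traceExcess r.ρ β L' (m' + 2) := hup
        _ ≤ 2 * (C * x ^ 2) := by linarith
        _ ≤ 2 * (C * ((1 + x₀) ^ 2 / 2 * δ) ^ 2) := by nlinarith [mul_le_mul_of_nonneg_left hx2 hC.le]
        _ = C * (1 + x₀) ^ 4 / 2 * δ ^ 2 := by ring
    calc coldDefect r.ρ β L' ≤ C * (1 + x₀) ^ 4 / 2 * coldDefect r.ρ β L ^ 2 := hgoal
      _ ≤ CR * coldDefect r.ρ β L ^ 2 :=
          mul_le_mul_of_nonneg_right (le_max_left _ _) (sq_nonneg _)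
  · -- large-defect regime: free
    push Not at hsmall
    have h1 : 1 ≤ η₀⁻¹ ^ 2 * coldDefect r.ρ β L ^ 2 := by
      have hη : η₀⁻¹ * coldDefect r.ρ β L ≥ 1 := by
        rw [ge_iff_le, inv_mul_eq_div, le_div_iff₀ hη₀pos]; linarith
      have : (η₀⁻¹ * coldDefect r.ρ β L) ^ 2 ≥ 1 := by nlinarith
      calc (1 : ℝ) ≤ (η₀⁻¹ * coldDefect r.ρ β L) ^ 2 := this
        _ = η₀⁻¹ ^ 2 * coldDefect r.ρ β L ^ 2 := by ring
    calc coldDefect r.ρ β L' ≤ 1 := hδL'le1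
      _ ≤ η₀⁻¹ ^ 2 * coldDefect r.ρ β L ^ 2 := h1
      _ ≤ CR * coldDefect r.ρ β L ^ 2 :=
          mul_le_mul_of_nonneg_right (le_max_right _ _) (sq_nonneg _)

/-- **R ⇒ spectral contraction (PROVED): the re-typing is an EQUIVALENCE up to constants.**  Given R with constant `C`,
take `x₀ = min 1 (1/(16C))`: if `x(L) ≤ x₀` then `δᶜ(L) ≤ 2x(L)`, so `δᶜ(L') ≤ C·δᶜ(L)² ≤ 4C·x(L)² ≤ 1/4`, whence
`x(L') ≤ 2δᶜ(L') ≤ 8C·x(L)²`. -/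
theorem spectral_of_coldDoublingRecursionSC (hR : ColdDoublingRecursionSC) : SpectralDiagonalContractionSC := by
  intro G _ _ _ _ hG hsc
  letI : MeasurableSpace G := borel G
  haveI : BorelSpace G := ⟨rfl⟩
  intro r
  haveI : SecondCountableTopology G :=
    (r.continuous.isClosedEmbedding r.injective).isEmbedding.secondCountableTopology
  obtain ⟨C, β₀, L₀, hC, h⟩ := hR G hG hsc r
  set x₀ : ℝ := min 1 (1 / (16 * C)) with hx₀
  have hx₀pos : 0 < x₀ := lt_min one_pos (by positivity)
  have hx₀1 : x₀ ≤ 1 := min_le_left _ _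
  have hx₀C : x₀ ≤ 1 / (16 * C) := min_le_right _ _
  refine ⟨x₀, hx₀pos, 8 * C, by positivity, max β₀ 0, max L₀ 8, ?_⟩
  intro β hβ L _ m hm hL L' _ m' hm' hLL' hL'L hx
  have hβ0 : 0 ≤ β := le_trans (le_max_right _ _) hβ
  have hββ₀ : β₀ ≤ β := le_trans (le_max_left _ _) hβ
  have hLL₀ : L₀ ≤ L := le_trans (le_max_left _ _) hL
  set x : ℝ := traceExcess r.ρ β L (m + 2) with hxdef
  -- `δ(L) ≤ 2x`, `x ≥ 0`
  have hup := one_sub_ratio_le_two_mul_traceExcess r hβ0 L m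
  have hδ0 : 0 ≤ 1 - wilsonFinTorusPartition r.ρ β L L L (2 * (m + 2)) /
      wilsonFinTorusPartition r.ρ β L L L (m + 2) ^ 2 :=
    coldDefect_nonneg r.continuous r.mem_unitary hβ0 L (m + 2) (by omega)
  have hxnn : 0 ≤ x := by nlinarith [hup, hδ0]
  have hδL : coldDefect r.ρ β L = 1 - wilsonFinTorusPartition r.ρ β L L L (2 * (m + 2)) /
      wilsonFinTorusPartition r.ρ β L L L (m + 2) ^ 2 := by unfold coldDefect; rw [hm]
  have hδL' : coldDefect r.ρ β L' = 1 - wilsonFinTorusPartition r.ρ β L' L' L' (2 * (m' + 2)) /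
      wilsonFinTorusPartition r.ρ β L' L' L' (m' + 2) ^ 2 := by unfold coldDefect; rw [hm']
  have hRβ := h β hββ₀ L hLL₀ L' hLL' hL'L
  -- `δ(L') ≤ C δ(L)² ≤ 4 C x²`
  have hδLle : coldDefect r.ρ β L ≤ 2 * x := by rw [hδL]; exact hup
  have hδLnn : 0 ≤ coldDefect r.ρ β L := by rw [hδL]; exact hδ0
  have hsq : coldDefect r.ρ β L ^ 2 ≤ (2 * x) ^ 2 := pow_le_pow_left₀ hδLnn hδLle 2
  have hδL'le : coldDefect r.ρ β L' ≤ 4 * C * x ^ 2 := by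
    calc coldDefect r.ρ β L' ≤ C * coldDefect r.ρ β L ^ 2 := hRβ
      _ ≤ C * (2 * x) ^ 2 := mul_le_mul_of_nonneg_left hsq hC.le
      _ = 4 * C * x ^ 2 := by ring
  -- `4 C x² ≤ 1/4` since `x ≤ x₀ ≤ min 1 (1/(16C))`
  have hx2 : x ^ 2 ≤ x₀ * (1 / (16 * C)) := by
    have h1 : x ^ 2 ≤ x₀ ^ 2 := pow_le_pow_left₀ hxnn hx 2
    have h2 : x₀ ^ 2 ≤ x₀ * (1 / (16 * C)) := by
      rw [sq]; exact mul_le_mul_of_nonneg_left hx₀C hx₀pos.le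
    exact h1.trans h2
  have hquarter : coldDefect r.ρ β L' ≤ 1 / 4 := by
    have : 4 * C * x ^ 2 ≤ 4 * C * (x₀ * (1 / (16 * C))) := mul_le_mul_of_nonneg_left hx2 (by positivity)
    have h' : 4 * C * (x₀ * (1 / (16 * C))) = x₀ / 4 := by field_simp; ring
    linarith
  -- `x(L') ≤ 2 δ(L')`
  have hxL' : traceExcess r.ρ β L' (m' + 2) ≤ 2 * coldDefect r.ρ β L' := by
    refine traceExcess_le_of_coldDefect_le r.continuous r.mem_unitary hβ0 L' m' (by linarith) ?_
    rw [← hδL']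
  calc traceExcess r.ρ β L' (m' + 2) ≤ 2 * coldDefect r.ρ β L' := hxL'
    _ ≤ 2 * (4 * C * x ^ 2) := by linarith
    _ = 8 * C * x ^ 2 := by ring

end Spectral

end Summit.QuantumFields.YangMills.Cruxes.IR.ColdPurityBridge

end
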